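import Summits.BirchSwinnertonDyer.BirchSwinnertonDyer.Theorems.MordellShaFreeCutKatoZetaRoadPinnedH2
import Summits.BirchSwinnertonDyer.BirchSwinnertonDyer.Theorems.CongruentShaFreeCutKatoZetaRoadReadings
import Summits.BirchSwinnertonDyer.BirchSwinnertonDyer.Theorems.CongruentShaFreeCutKatoReading31b
import HarnessLib

set_option linter.dupNamespace false
set_option autoImplicit false

/-! # Route `MordellShaFreeCut` (rung S2b) — crux B `AnalyticRankOneOfRankOneFiniteShaThree`
# (stmt-BirchSwinnertonDyer-19160): the END-STATE CENSUS of the Kato–zeta / Perrin-Riou road (line of record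
# `kato-zeta-perrin-riou`, registered 2026-08-26T21:27:04Z) — crux B BY NAME from ELEVEN NAMED FACTS and ONE
# research statement, every hypothesis a named tree `Prop` (no free schema)

Cell `bsd-cn100`, prover seat `bsd-cn100-s2b-c3` (g6). THEOREMS ONLY. Supports, does not close,
stmt-BirchSwinnertonDyer-19160. HONEST FRAMING: nothing here proves crux B, the leaf
`rankOne_threeConverse_mordellCurve`, Sylvester's problem or any case of BSD; the theorems display, as
hypotheses BY NAME, exactly what the registered skeleton's stubs `stub_refereedInputs` (citation-borne) and
`stub_prFormulaAtThree` (research) assert — so the kernel census of the road is one machine-checked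
signature. PARTITION: none — RANK axis. Build rule (H): concludes the route decl by name, hence imports the
road file `MordellShaFreeCutKatoZetaRoadPinnedH2` (S2b cone); the other two imports are Theses-free.

## The eleven named facts (all `Literature.NumberTheory.EllipticCurves…` / `….Kato2004…` `Prop`s)

Six REFEREED THEOREMS of the v2 composition (p419697): `p_parity` (Dokchitser–Dokchitser), `ModularForms.exists_isNewformOf`
(modularity), `HoffsteinLuo1997_exists_twist_L_one_ne_zero`, `kato_finite_of_L_one_ne_zero` (Kato Cor. 14.3),
`exists_isHeegnerPoint` (Gross 1984), `analyticRankEK_eq_one_iff_heegner_nonTorsion` (Gross–Zagier + Kolyvagin =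
[ABS] Thm. 10.8 (b)); five READING-grade typed statements of Kato, Astérisque 295: `Kato2004.nonempty_iwasawaH1Data`
(§8/§12: `𝐇¹_Γ(T_pW)` exists, bsd-smallim), `Kato2004.thm12_4` ((12.2.1) + Thm. 12.4 (2)), `Kato2004.nonempty_iwasawaH2Data`
(Thm. 12.4 (1) + (14.14.1), bsd-cn100-ty p463156), `Kato2004.finite_descentCokernel_of_rankOne` ((14.9.3) +
(14.14.1)–(14.14.2) in rank one, p464597), `Kato2004.locP_kernel_isTorsion_of_rankOne` (§14.1 + (14.9.3) in rank one,
this seat p471015). From these: (R+K) = `CongruentShaFreeCutKatoZetaRoadReadings.readingRK_jZero_three_of_facts`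
(bsd-cn100-ty g8, char-ideal algebra p469342; filed p471624), (3.1′) = the `h31` slot of `cruxB_of_prFormulaH2_of_fact31`
(p467387 over p466996), (3.1″) = `CongruentShaFreeCutKatoReading31b.reading31b_three_of_fact` (p471256 over p471031).
The ONE research statement: `PRFormulaAtThreeH2` (Perrin-Riou's formula for Kato's zeta element of a `j = 0` curve
at the additive prime `3`, [ABS] App. A Thm. 10.8 (a) shape; nearest refereed prior art Bertolini–Darmon–Venerucci
2022 Thm. A — any `E/ℚ`, semistable ODD `p`, the same Heegner-field shape; stated for every `(E, p)` as
Burungale–Skinner–Tian–Wan 2024 Conj. 1.12, proved there for `p ∤ 2N`; no source at an additive prime — lit g18).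

References: [AlpogeBhargavaShnidman2022] App. A Thm. 10.1, Thm. 10.6, Thm. 10.8, §10.1.3; [Kato2004Asterisque]
Thm. 12.4, (14.9.3), §14.14, Cor. 14.3; [BertoliniDarmonVenerucci2022] Thm. A; [BurungaleSkinnerTianWan2024]
Conj. 1.12, Thm. 1.13; [GrossZagier1986] Thm. I.6.3; [DokchitserDokchitserAnnals2010] Thm. 1.4.
-/

noncomputable section

open scoped Classical

open WeierstrassCurve NumberField IsDedekindDomain Field Literature.NumberTheory.EllipticCurves
  Literature.NumberTheory.EllipticCurves.Kato2004 Literature.NumberTheory.EllipticCurves.IwasawaAlgebra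
  Literature.NumberTheory.EllipticCurves.Kato2004.EulerSystemValues
  Literature.NumberTheory.GaloisRepresentations
  Summit.BirchSwinnertonDyer.Rank1Residual.Additive
  Summit.BirchSwinnertonDyer.BirchSwinnertonDyer.Theses.MordellShaFreeCut
  Summit.BirchSwinnertonDyer.BirchSwinnertonDyer.Theorems.CongruentShaFreeCutKatoDescentDatumOfH2
  Summit.BirchSwinnertonDyer.BirchSwinnertonDyer.Theorems.MordellShaFreeCutKatoZetaRoadPinnedH2

namespace Summit.BirchSwinnertonDyer.BirchSwinnertonDyer.Theorems.MordellShaFreeCutKatoZetaRoadFactsCensus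

/-- **Crux B `AnalyticRankOneOfRankOneFiniteShaThree` (stmt-BirchSwinnertonDyer-19160) from ELEVEN NAMED FACTS and
Perrin-Riou's formula** — the end-state census of the Kato–zeta road, every hypothesis a named tree `Prop`:
six refereed theorems (`3`-parity, modularity, Hoffstein–Luo, Kato finiteness, Heegner points, Gross–Zagier +
Kolyvagin), five reading-grade typed Kato statements (`nonempty_iwasawaH1Data`, `thm12_4`, `nonempty_iwasawaH2Data`,
`finite_descentCokernel_of_rankOne`, `locP_kernel_isTorsion_of_rankOne`), and the ONE research statement
`PRFormulaAtThreeH2`. Proof: `cruxB_of_prFormulaH2_of_fact31` (p467387) with (R+K) :=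
`readingRK_jZero_three_of_facts h1 h2 h12` (bsd-cn100-ty g8) and (3.1″) := `reading31b_three_of_fact h31b`.
CONDITIONAL on the twelve displayed hypotheses; closes nothing.
[cite: AlpogeBhargavaShnidman2022, App. A Thm. 10.1, Thm. 10.6, Thm. 10.8, §10.1.3 (pp. 33–34)]
[cite: Kato2004Asterisque, Thm. 12.4 (p. 221), (14.9.3) (p. 240), §14.14 (p. 243), Cor. 14.3 (p. 235)]
[cite: BertoliniDarmonVenerucci2022, Thm. A (nearest refereed prior art of the formula: semistable odd p)] -/
theorem cruxB_of_namedFacts_of_prFormulaH2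
    (hpar : ∀ (W : WeierstrassCurve ℚ) [W.IsElliptic] (p : ℕ) [Fact p.Prime], p_parity W p)
    (hmod : ModularForms.exists_isNewformOf) (hHL : HoffsteinLuo1997_exists_twist_L_one_ne_zero)
    (hKato : ∀ (W : WeierstrassCurve ℚ) [W.IsElliptic] (p : ℕ) [Fact p.Prime],
      kato_finite_of_L_one_ne_zero W p)
    (hHP : ∀ (W : WeierstrassCurve ℚ) (K : Type) [Field K] [NumberField K],
      exists_isHeegnerPoint W K)
    (hGZ : ∀ (W : WeierstrassCurve ℚ) (N : ℕ) [NeZero N] (K : Type) [Field K] [NumberField K],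
      analyticRankEK_eq_one_iff_heegner_nonTorsion W N K)
    (h1 : nonempty_iwasawaH1Data) (h2 : nonempty_iwasawaH2Data) (h12 : thm12_4)
    (h31 : finite_descentCokernel_of_rankOne) (h31b : locP_kernel_isTorsion_of_rankOne)
    (hPR : PRFormulaAtThreeH2) :
    AnalyticRankOneOfRankOneFiniteShaThree :=
  cruxB_of_prFormulaH2_of_fact31 hpar hmod hHL hKato hHP hGZ
    (CongruentShaFreeCutKatoZetaRoadReadings.readingRK_jZero_three_of_facts h1 h2 h12) h31
    (CongruentShaFreeCutKatoReading31b.reading31b_three_of_fact h31b) hPR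

/-- **The registered skeleton's composition as a tree theorem**: crux B from the 11-conjunct bundle of the
registered stub `stub_refereedInputs` of line `kato-zeta-perrin-riou` (v1d shape: the six refereed facts ∧
`nonempty_iwasawaH1Data ∧ nonempty_iwasawaH2Data ∧ thm12_4 ∧ finite_descentCokernel_of_rankOne ∧
locP_kernel_isTorsion_of_rankOne`, token for token) and `PRFormulaAtThreeH2` — so a proof of the research
formula closes crux B in one line modulo the citation-borne bundle. CONDITIONAL; closes nothing.
[cite: AlpogeBhargavaShnidman2022, App. A Thm. 10.1 and §10.1.3 (pp. 33–34)] [cite: Kato2004Asterisque, Thm. 12.4, (14.9.3), §14.14] -/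
theorem cruxB_of_refereedInputs_of_prFormulaH2
    (RI : (∀ (W : WeierstrassCurve ℚ) [W.IsElliptic] (p : ℕ) [Fact p.Prime], p_parity W p) ∧
      ModularForms.exists_isNewformOf ∧
      HoffsteinLuo1997_exists_twist_L_one_ne_zero ∧
      (∀ (W : WeierstrassCurve ℚ) [W.IsElliptic] (p : ℕ) [Fact p.Prime],
        kato_finite_of_L_one_ne_zero W p) ∧
      (∀ (W : WeierstrassCurve ℚ) (K : Type) [Field K] [NumberField K], exists_isHeegnerPoint W K) ∧
      (∀ (W : WeierstrassCurve ℚ) (N : ℕ) [NeZero N] (K : Type) [Field K] [NumberField K],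
        analyticRankEK_eq_one_iff_heegner_nonTorsion W N K) ∧
      nonempty_iwasawaH1Data ∧ nonempty_iwasawaH2Data ∧ thm12_4 ∧ finite_descentCokernel_of_rankOne ∧
      locP_kernel_isTorsion_of_rankOne)
    (hPR : PRFormulaAtThreeH2) :
    AnalyticRankOneOfRankOneFiniteShaThree :=
  cruxB_of_namedFacts_of_prFormulaH2 RI.1 RI.2.1 RI.2.2.1 RI.2.2.2.1 RI.2.2.2.2.1 RI.2.2.2.2.2.1
    RI.2.2.2.2.2.2.1 RI.2.2.2.2.2.2.2.1 RI.2.2.2.2.2.2.2.2.1 RI.2.2.2.2.2.2.2.2.2.1 RI.2.2.2.2.2.2.2.2.2.2 hPR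

end Summit.BirchSwinnertonDyer.BirchSwinnertonDyer.Theorems.MordellShaFreeCutKatoZetaRoadFactsCensus

end
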